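import Mathlib
import Summits.ResolutionOfSingularities.ResolutionOfSingularities.Theorems.SandwichedSingularitiesResolution
import Literature.AlgebraicGeometry.Resolution.ResolutionOfSingularities
import Literature.AlgebraicGeometry.Resolution.AlterationsResolution
import Literature.AlgebraicGeometry.Resolution.PrincipalizationToResolution
import HarnessLib

/-!
# Slices of the conjectures SANDᴸ / SANDʷ: dimension split, `ResolutionInChar p ⇒` them,
# SANDᴸ `⇒` SANDʷ, dimension `≤ 3` from Cossart–Piltant

Crux `stmt-ResolutionOfSingularities-0642` (`Valuative.PatchingRel`), line `sandwiched-gluing`, gen-1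
cut. The conjecture leaf `Theorems/SandwichedSingularitiesResolution.lean` states SANDᴸ(p)
(`SandwichedLocusResolution p`: resolution of a variety over a sandwiched-singularity open),
its slices `…DimLe p d` / `…DimGt p d`, and the absolute form SANDʷ(p)
(`SandwichedSingularitiesResolution p`); this file proves the formal relations:

* `sandwichedLocusResolution_iff_dimLe_and_dimGt` — SANDᴸ(p) ⟺ (dim `≤ d`) ∧ (dim `> d`);
* `sandwichedLocusResolution_of_resolutionInChar`, `sandwichedSingularitiesResolution_of_resolutionInChar`
  — both atoms are SLICES of the weak summit statement (no slack), hence irrefutable short of a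
  counterexample to resolution in characteristic `p`;
* `sandwichedLocusResolutionDimLe_three_of_cossartPiltant` — dimension `≤ 3` from the named fact
  `CossartPiltant2019` (Thm. 1.1, weak form), and `sandwichedLocusResolution_iff_dimGt_three` —
  modulo that fact the atom IS its dimension-`> 3` slice.

## References

* V. Cossart, O. Piltant, *Resolution of singularities of arithmetical threefolds*, J. Algebra
  529 (2019) 268–535, Thm. 1.1. [CossartPiltant2019]
* O. Piltant, *An axiomatic version of Zariski's patching theorem*, RACSAM 107 (2013) 91–121,
  p. 2. [Piltant2013]
-/

-- `Summit.<Summit>.<Sub>[.Theorems]` with `Sub = Summit` (single-conjunct summit, D-0017): the duplicated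
-- namespace component is the tree layout.
set_option linter.dupNamespace false

noncomputable section

namespace Summit.ResolutionOfSingularities.ResolutionOfSingularities.Theorems

open CategoryTheory AlgebraicGeometry
open Literature.AlgebraicGeometry.Resolution

universe u

/-- SANDᴸ(p) is the conjunction of its dimension-`≤ d` and dimension-`> d` slices. [folklore] -/
theorem sandwichedLocusResolution_iff_dimLe_and_dimGt (p d : ℕ) :
    SandwichedLocusResolution.{u} p ↔
      SandwichedLocusResolutionDimLe.{u} p d ∧ SandwichedLocusResolutionDimGt.{u} p d := by
  constructor
  · intro h
    exact ⟨fun k _ _ U M f g O V η h₁ h₂ h₃ h₄ h₅ h₆ h₇ h₈ h₉ h₁₀ h₁₁ h₁₂ h₁₃ h₁₄ _ =>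
        h k U M f g O V η h₁ h₂ h₃ h₄ h₅ h₆ h₇ h₈ h₉ h₁₀ h₁₁ h₁₂ h₁₃ h₁₄,
      fun k _ _ U M f g O V η h₁ h₂ h₃ h₄ h₅ h₆ h₇ h₈ h₉ h₁₀ h₁₁ h₁₂ h₁₃ h₁₄ _ =>
        h k U M f g O V η h₁ h₂ h₃ h₄ h₅ h₆ h₇ h₈ h₉ h₁₀ h₁₁ h₁₂ h₁₃ h₁₄⟩
  · rintro ⟨hle, hgt⟩ k _ _ U M f g O V η h₁ h₂ h₃ h₄ h₅ h₆ h₇ h₈ h₉ h₁₀ h₁₁ h₁₂ h₁₃ h₁₄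
    rcases le_or_gt (topologicalKrullDim M) (d : WithBot ℕ∞) with hd | hd
    · exact hle k U M f g O V η h₁ h₂ h₃ h₄ h₅ h₆ h₇ h₈ h₉ h₁₀ h₁₁ h₁₂ h₁₃ h₁₄ hd
    · exact hgt k U M f g O V η h₁ h₂ h₃ h₄ h₅ h₆ h₇ h₈ h₉ h₁₀ h₁₁ h₁₂ h₁₃ h₁₄ hd

/-- A resolution of an integral `M` is, in particular, a resolution of `M` over any open `O`.
[folklore] -/
theorem exists_of_hasResolution {M : Scheme.{u}} [IsIntegral M] (h : Scheme.HasResolution M)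
    (O : M.Opens) :
    ∃ (N : Scheme.{u}) (ρ : N ⟶ M), IsIntegral N ∧ IsProper ρ ∧ IsBirational ρ ∧
      ∀ n : N, ρ n ∈ O → IsRegularLocalRing (N.presheaf.stalk n) := by
  obtain ⟨N, ρ, hres⟩ := h
  haveI := hres.isRegular.isReduced
  exact ⟨N, ρ, hres.isBirational.isIntegral, hres.isProper, hres.isBirational,
    fun n _ => hres.isRegular n⟩

/-- **No slack: `ResolutionInChar p ⇒` SANDᴸ(p)** — resolve the integral separated finite-type
`k`-scheme `M` itself. [folklore] -/
theorem sandwichedLocusResolution_of_resolutionInChar {p : ℕ} (h : ResolutionInChar.{u} p) :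
    SandwichedLocusResolution.{u} p :=
  fun k _ _ _ M _ g O _ _ _ _ _ _ _ hg₁ hg₂ hg₃ _ _ _ _ _ _ =>
    exists_of_hasResolution (h k M g hg₁ hg₂ hg₃ inferInstance) O

/-- **No slack: `ResolutionInChar p ⇒` SANDʷ(p)** — the scheme `X` of the statement is a reduced
separated `k`-scheme of finite type. [folklore] -/
theorem sandwichedSingularitiesResolution_of_resolutionInChar {p : ℕ}
    (h : ResolutionInChar.{u} p) : SandwichedSingularitiesResolution.{u} p :=
  fun k _ _ _ X _ g _ _ _ _ _ _ _ hg₁ hg₂ hg₃ _ _ _ _ _ => h k X g hg₁ hg₂ hg₃ inferInstance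

/-- **Registered stub of line `sandwiched-gluing`** (universe `0`): `ResolutionInChar p ⇒`
SANDᴸ(p) — the atom is a slice of the weak summit statement. [folklore] -/
theorem stub_sandwichedLocus_of_resolutionInChar :
    ∀ p : ℕ, ResolutionInChar.{0} p → SandwichedLocusResolution.{0} p :=
  fun _ h => sandwichedLocusResolution_of_resolutionInChar h

/-- Characteristic zero: SANDᴸ(0) from Hironaka's theorem (the named fact `Hironaka1964`, i.e.
`ResolutionInChar 0`). [cite: Hironaka1964, Main Theorem I] -/
theorem sandwichedLocusResolution_zero_of_hironaka (h : Hironaka1964.{u}) :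
    SandwichedLocusResolution.{u} 0 :=
  sandwichedLocusResolution_of_resolutionInChar h

/-- The summit statement gives SANDᴸ(p) for every prime `p` (universe `0`). [folklore] -/
theorem sandwichedLocusResolution_of_resolutionOfSingularities
    (h : Literature.AlgebraicGeometry.Resolution.ResolutionOfSingularities) (p : ℕ) (hp : p.Prime) :
    SandwichedLocusResolution.{0} p :=
  sandwichedLocusResolution_of_resolutionInChar (h p hp)

/-- **Dimension `≤ 3`: SANDᴸ(p) from Cossart–Piltant 2019** (Thm. 1.1 in the weak form
`CossartPiltant2019`: every reduced separated scheme of finite type over a field, of dimension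
`≤ 3`, has a resolution — applied to `M`). CONDITIONAL on that named fact.
[cite: CossartPiltant2019, Thm. 1.1] -/
theorem sandwichedLocusResolutionDimLe_three_of_cossartPiltant (h : CossartPiltant2019.{u})
    (p : ℕ) : SandwichedLocusResolutionDimLe.{u} p 3 :=
  fun k _ _ _ M _ g O _ _ _ _ _ _ _ hg₁ hg₂ hg₃ _ _ _ _ _ _ hdim =>
    exists_of_hasResolution (h k M g hg₁ hg₂ hg₃ inferInstance (by exact_mod_cast hdim)) O

/-- Hence, modulo `CossartPiltant2019`, SANDᴸ(p) is equivalent to its dimension-`> 3` slice: the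
open content of the atom is exactly "resolution over sandwiched-singularity opens of varieties of
dimension `≥ 4` in characteristic `p`". [cite: CossartPiltant2019, Thm. 1.1] -/
theorem sandwichedLocusResolution_iff_dimGt_three (h : CossartPiltant2019.{u}) (p : ℕ) :
    SandwichedLocusResolution.{u} p ↔ SandwichedLocusResolutionDimGt.{u} p 3 := by
  rw [sandwichedLocusResolution_iff_dimLe_and_dimGt p 3]
  exact ⟨fun h' => h'.2, fun h' => ⟨sandwichedLocusResolutionDimLe_three_of_cossartPiltant h p, h'⟩⟩

end Summit.ResolutionOfSingularities.ResolutionOfSingularities.Theorems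


end
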